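import Summits.Schanuel.Schanuel.Theorems.RootDecomp1BFinitePinningFloor05

/-!
# `RootDecomp1BFinitePinningFloor` — part 06 of 06 (`RootDecomp1BFinitePinningFloor06`): §10 THE PERIOD-PACKAGE FLOOR COMPLETED — pinning the period costs nothing (`transcendental_of_not_mem_spanOnePi`, `linearIndependent_ofReal_pair`, `modulus_algebraic`, `phase_algebraic`, `tame_algebraic`, `polarPair_algebraic`, `not_localSurplusBudgetE_shear`, `not_tameDefectZeroStepE_shear`, `not_schanuelRankE_two_shear`, `periodFloor_reduction`, `periodFloor`, `periodPackageFloor`, `localSurplusBudget_false_without_channel_beyond_periods`, `tameDefectZeroStep_false_without_channel_beyond_periods`, `kleinPolarSchanuel_false_without_channel_beyond_periods'`, the hypothesis-free `…_beyond_kernel_and_period_plane` forms, `periodPackageFloor_exp_dictionary`): the `(3+4i)/5` model fails `X(1)`, `LSB(1)` (crux 27214), `T0(0)` (crux 32407), `S(2)` and the summit text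

Part 6 of the port of the lens-4 gen-23 kernel `FinitePinningFloor.lean` (see part 01 for the overview, the construction of pinned shears and the reading for the crux). PORT in six parts (≤ 400 lines each, shared namespace `Summit.Schanuel.Schanuel.Theorems.RootDecomp1BFinitePinningFloor`, each part importing the previous; `--supports stmt-Schanuel-24622`) of the decomp-schanuel lens-4 kernel file `HOME/decomp-schanuel-lens-4/g23/FinitePinningFloor.lean` (gen 23, 2026-08-30, sha256 e15f30e40adeef47…; `lean check` rc 0 · 0 sorry · standard axioms). 
-/

noncomputable section

open Complex

namespace Summit.Schanuel.Schanuel.Theorems.RootDecomp1BFinitePinningFloor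

open Summit.Schanuel.Schanuel.Theorems.RootDecomp1BTranscendencePackageFloor
open Summit.Schanuel.Schanuel.Theorems.RootDecomp1BPeriodKernelFloor
open Literature.NumberTheory.Transcendental (nesterenko baker_holds SchanuelRank transcendental_pi_holds)

/-! ## §1 Helpers (part-local copies of the private helpers of the kernel file) -/

/-- An element of an intermediate field `K` is algebraic over `K`. [folklore] -/
private theorem alg_of_mem {K : IntermediateField ℚ ℂ} {x : ℂ} (hx : x ∈ K) : IsAlgebraic K x :=
  isAlgebraic_algebraMap (⟨x, hx⟩ : K)

/-- `i` is algebraic. [folklore] -/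
private theorem alg_I : IsAlgebraic ℚ I := mem_Qb_iff.mp I_mem_Qb

/-! ## §10 THE PERIOD-PACKAGE FLOOR COMPLETED — pinning the period costs NOTHING: the `(3+4i)/5`
model also fails `LSB(1)`, `T0(0)`, `S(2)` and the summit text (added on top of §9)

Part PKF02 recorded as NOT claimed: `¬ LocalSurplusBudgetE E₁`, `¬ TameDefectZeroStepE E₁` for a
PERIOD-package model (`E₁` fails only at length two, where the Klein induction hypothesis contains
open cells) and explained the loss of one storey as «forced for shear models». The dichotomy of §9
removes the loss: the pinned shear at `r ∈ {γ₀, γ₀²}` has a TRANSCENDENTAL FIXED POINT `E r = r` with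
`E(ir)` ALGEBRAIC, so at LENGTH ONE — where the Klein induction hypothesis is vacuous
(`kleinIH_one`) — `trdeg ℚ(r) = trdeg ℚ(r, E r) = trdeg ℚ(ir, E(ir)) = t(r) = 1`: the local
side-surplus budget `2 + 1 ≤ 1 + 1` fails, the tame defect-zero step (tame: ONE relation; initial
bound `t ≥ 1` true) concludes `t ≥ 2` falsely, and Schanuel in rank two fails at the `ℚ`-free,
`conj`-stable polar pair `(r, ir)`. Hence `periodPackageFloor`: ONE exponential with (E1)–(E4),
(P1)–(P3) failing `X`, `LSB`, `T0`, `S(2)`, `S` — exactly the profile of the twist floor `E₀` of part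
TPF05 (`transcendencePackageFloor`), now WITH the period package. -/

/-- A subfield containing a transcendental element has transcendence degree `≥ 1`. [folklore] -/
private theorem one_le_trdeg_of_transcendental_mem' {L : IntermediateField ℚ ℂ} {w : ℂ}
    (hw : w ∈ L) (ht : Transcendental ℚ w) : (1 : Cardinal) ≤ Algebra.trdeg ℚ L := by
  haveI : Algebra.Transcendental ℚ L :=
    ⟨⟨⟨w, hw⟩, fun h => ht (IntermediateField.isAlgebraic_iff.mp h)⟩⟩
  exact Cardinal.one_le_iff_pos.mpr (_root_.trdeg_pos ℚ L)

/-- Algebraic reals lie in `A ⊕ Aπ`. [folklore] -/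
theorem mem_spanOnePi_of_mem_A {x : ℝ} (hx : x ∈ A) : x ∈ spanOnePi := by
  have e : ((⟨x, hx⟩ : A) • (1 : ℝ)) = x := by
    rw [Algebra.smul_def, mul_one]
    rfl
  rw [← e]
  exact Submodule.smul_mem _ _ one_mem_spanOnePi

/-- A real outside `A ⊕ Aπ` is transcendental. [folklore] -/
theorem transcendental_of_not_mem_spanOnePi {r : ℝ} (hr : r ∉ spanOnePi) :
    Transcendental ℚ ((r : ℝ) : ℂ) := fun h =>
  hr (mem_spanOnePi_of_mem_A (mem_A_iff_coe_mem_Qb.mpr (mem_Qb_iff.mpr h)))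

/-- A real outside `A ⊕ Aπ` is non-zero. [folklore] -/
theorem ne_zero_of_not_mem_spanOnePi {r : ℝ} (hr : r ∉ spanOnePi) : r ≠ 0 := fun h0 =>
  hr (h0 ▸ Submodule.zero_mem _)

/-- `(r, ir)` is `ℚ`-free for a non-zero real `r`. [folklore] -/
theorem linearIndependent_ofReal_pair {r : ℝ} (hr : r ≠ 0) :
    LinearIndependent ℚ ![(r : ℂ), (r : ℂ) * I] := by
  rw [LinearIndependent.pair_iff]
  intro s t h
  rw [Rat.smul_def, Rat.smul_def] at h
  have hre := congrArg Complex.re h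
  have him := congrArg Complex.im h
  simp [hr] at hre him
  exact ⟨hre, him⟩

section ShearFloor

variable (S : Shear) (K : IntermediateField ℚ ℂ)

/-- MODULUS side of the length-one cell of a shear: `u, E u = e^ℓ` are algebraic over any
`K ∋ u, e^ℓ`. [folklore] -/
theorem modulus_algebraic (hr : ((S.u : ℝ) : ℂ) ∈ K) (hs : cexp (S.ℓ : ℂ) ∈ K) :
    ∀ x ∈ Set.range (fun j => (((![S.u] : Fin 1 → ℝ) j : ℝ) : ℂ)) ∪
      Set.range (S.E ∘ fun j => (((![S.u] : Fin 1 → ℝ) j : ℝ) : ℂ)), IsAlgebraic K x := by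
  have ar : IsAlgebraic K ((S.u : ℝ) : ℂ) := alg_of_mem hr
  have hEu : S.E (S.u : ℂ) = cexp (S.ℓ : ℂ) := E_u S
  rintro x (⟨j, rfl⟩ | ⟨j, rfl⟩)
  · fin_cases j
    simpa using ar
  · fin_cases j
    simpa [hEu] using alg_of_mem hs

/-- PHASE side of the length-one cell of a shear: `iu, E(iu) = e^{iℓ}` are algebraic over any
`K ∋ u, e^{iℓ}`. [folklore] -/
theorem phase_algebraic (hr : ((S.u : ℝ) : ℂ) ∈ K) (his : cexp ((S.ℓ : ℂ) * I) ∈ K) :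
    ∀ x ∈ Set.range (fun j => (((![S.u] : Fin 1 → ℝ) j : ℝ) : ℂ) * Complex.I) ∪
      Set.range (S.E ∘ fun j => (((![S.u] : Fin 1 → ℝ) j : ℝ) : ℂ) * Complex.I), IsAlgebraic K x := by
  have aI : IsAlgebraic K I := alg_I.tower_top (L := K)
  have ar : IsAlgebraic K ((S.u : ℝ) : ℂ) := alg_of_mem hr
  have hEuI : S.E ((S.u : ℂ) * I) = cexp ((S.ℓ : ℂ) * I) := E_u_mul_I S
  rintro x (⟨j, rfl⟩ | ⟨j, rfl⟩)
  · fin_cases j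
    simpa using ar.mul aI
  · fin_cases j
    simpa [hEuI] using alg_of_mem his

/-- TAME generating set `u, E u, E(iu)` of a shear: algebraic over any `K ∋ u, e^ℓ, e^{iℓ}`.
[folklore] -/
theorem tame_algebraic (hr : ((S.u : ℝ) : ℂ) ∈ K) (hs : cexp (S.ℓ : ℂ) ∈ K)
    (his : cexp ((S.ℓ : ℂ) * I) ∈ K) :
    ∀ x ∈ Set.range (fun j => (((![S.u] : Fin (0 + 1) → ℝ) j : ℝ) : ℂ)) ∪
      {S.E (((![S.u] : Fin (0 + 1) → ℝ) (Fin.last 0) : ℝ) : ℂ),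
        S.E ((((![S.u] : Fin (0 + 1) → ℝ) (Fin.last 0) : ℝ) : ℂ) * Complex.I)},
      IsAlgebraic K x := by
  have ar : IsAlgebraic K ((S.u : ℝ) : ℂ) := alg_of_mem hr
  have hEu : S.E (S.u : ℂ) = cexp (S.ℓ : ℂ) := E_u S
  have hEuI : S.E ((S.u : ℂ) * I) = cexp ((S.ℓ : ℂ) * I) := E_u_mul_I S
  rintro x (⟨j, rfl⟩ | hx)
  · fin_cases j
    simpa using ar
  · rcases hx with rfl | rfl
    · simpa [hEu] using alg_of_mem hs
    · simpa [hEuI] using alg_of_mem his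

/-- The `conj`-stable polar PAIR `(u, iu)` of a shear with its values: algebraic over any
`K ∋ u, e^ℓ, e^{iℓ}`. [folklore] -/
theorem polarPair_algebraic (hr : ((S.u : ℝ) : ℂ) ∈ K) (hs : cexp (S.ℓ : ℂ) ∈ K)
    (his : cexp ((S.ℓ : ℂ) * I) ∈ K) :
    ∀ x ∈ Set.range ![((S.u : ℝ) : ℂ), ((S.u : ℝ) : ℂ) * I] ∪
      Set.range (S.E ∘ ![((S.u : ℝ) : ℂ), ((S.u : ℝ) : ℂ) * I]), IsAlgebraic K x := by
  have aI : IsAlgebraic K I := alg_I.tower_top (L := K)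
  have ar : IsAlgebraic K ((S.u : ℝ) : ℂ) := alg_of_mem hr
  have hEu : S.E (S.u : ℂ) = cexp (S.ℓ : ℂ) := E_u S
  have hEuI : S.E ((S.u : ℂ) * I) = cexp ((S.ℓ : ℂ) * I) := E_u_mul_I S
  rintro x (⟨j, rfl⟩ | ⟨j, rfl⟩)
  · fin_cases j
    · simpa using ar
    · simpa using ar.mul aI
  · fin_cases j
    · simpa [hEu] using alg_of_mem hs
    · simpa [hEuI] using alg_of_mem his

/-- **`LSB(1)` FAILS** for a shear with `u` transcendental and `trdeg ℚ(u, e^ℓ, e^{iℓ}) ≤ 1`: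
`2·1 + trdeg ℚ(u) = 3 > trdeg ℚ(u, E u) + trdeg ℚ(iu, E(iu)) = 1 + 1` (the Klein induction
hypothesis below length one is vacuous). [folklore] -/
theorem not_localSurplusBudgetE_shear (hK : Algebra.trdeg ℚ K ≤ 1) (hr : ((S.u : ℝ) : ℂ) ∈ K)
    (hs : cexp (S.ℓ : ℂ) ∈ K) (his : cexp ((S.ℓ : ℂ) * I) ∈ K)
    (hut : Transcendental ℚ ((S.u : ℝ) : ℂ)) : ¬ LocalSurplusBudgetE S.E := by
  intro h
  have hu0 : S.u ≠ 0 := by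
    intro h0
    apply hut
    rw [h0, Complex.ofReal_zero]
    exact isAlgebraic_zero
  have hli : LinearIndependent ℚ (![S.u] : Fin 1 → ℝ) :=
    linearIndependent_unique_iff.mpr (by simpa using hu0)
  have h1 := h 1 ![S.u] hli (kleinIH_one S.E)
  have hA : (1 : Cardinal) ≤ Algebra.trdeg ℚ
      ↥(IntermediateField.adjoin ℚ (Set.range fun j => (((![S.u] : Fin 1 → ℝ) j : ℝ) : ℂ))) :=
    one_le_trdeg_of_transcendental_mem'
      (IntermediateField.subset_adjoin ℚ _ ⟨0, by simp⟩) hut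
  have hB : Algebra.trdeg ℚ ↥(IntermediateField.adjoin ℚ (Set.range (fun j => (((![S.u] : Fin 1 → ℝ) j : ℝ) : ℂ)) ∪ Set.range (S.E ∘ fun j => (((![S.u] : Fin 1 → ℝ) j : ℝ) : ℂ)))) ≤ 1 :=
    (RootDecomp1EAnchor.trdeg_adjoin_le_of_isAlgebraic (modulus_algebraic S K hr hs)).trans hK
  have hC : Algebra.trdeg ℚ ↥(IntermediateField.adjoin ℚ (Set.range (fun j => (((![S.u] : Fin 1 → ℝ) j : ℝ) : ℂ) * Complex.I) ∪ Set.range (S.E ∘ fun j => (((![S.u] : Fin 1 → ℝ) j : ℝ) : ℂ) * Complex.I))) ≤ 1 :=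
    (RootDecomp1EAnchor.trdeg_adjoin_le_of_isAlgebraic (phase_algebraic S K hr his)).trans hK
  have h2 : ((1 + 1 : ℕ) : Cardinal) + 1 ≤ (1 : Cardinal) + 1 :=
    calc ((1 + 1 : ℕ) : Cardinal) + 1
        ≤ ((1 + 1 : ℕ) : Cardinal) + Algebra.trdeg ℚ ↥(IntermediateField.adjoin ℚ
            (Set.range fun j => (((![S.u] : Fin 1 → ℝ) j : ℝ) : ℂ))) := add_le_add le_rfl hA
      _ ≤ _ := h1
      _ ≤ (1 : Cardinal) + 1 := add_le_add hB hC
  norm_num at h2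

/-- **`T0(0)` FAILS** for a shear with `u` transcendental and `trdeg ℚ(u, e^ℓ, e^{iℓ}) ≤ 1`: `u` is
TAME for `E` (`trdeg ℚ(u, E u, E(iu)) = 1 ≤ trdeg ℚ(u) + 1`), the initial bound `t ≥ 1` holds
(`u` transcendental), but `t = 1 < 2`. [folklore] -/
theorem not_tameDefectZeroStepE_shear (hK : Algebra.trdeg ℚ K ≤ 1) (hr : ((S.u : ℝ) : ℂ) ∈ K)
    (hs : cexp (S.ℓ : ℂ) ∈ K) (his : cexp ((S.ℓ : ℂ) * I) ∈ K)
    (hut : Transcendental ℚ ((S.u : ℝ) : ℂ)) : ¬ TameDefectZeroStepE S.E := by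
  intro h
  have hu0 : S.u ≠ 0 := by
    intro h0
    apply hut
    rw [h0, Complex.ofReal_zero]
    exact isAlgebraic_zero
  have hli : LinearIndependent ℚ (![S.u] : Fin 1 → ℝ) :=
    linearIndependent_unique_iff.mpr (by simpa using hu0)
  have htame : Algebra.trdeg ℚ ↥(IntermediateField.adjoin ℚ (Set.range (fun j => (((![S.u] : Fin (0 + 1) → ℝ) j : ℝ) : ℂ)) ∪ {S.E (((![S.u] : Fin (0 + 1) → ℝ) (Fin.last 0) : ℝ) : ℂ), S.E ((((![S.u] : Fin (0 + 1) → ℝ) (Fin.last 0) : ℝ) : ℂ) * Complex.I)})) ≤ Algebra.trdeg ℚ ↥(IntermediateField.adjoin ℚ (Set.range (fun j => (((![S.u] : Fin (0 + 1) → ℝ) j : ℝ) : ℂ)))) + 1 :=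
    ((RootDecomp1EAnchor.trdeg_adjoin_le_of_isAlgebraic (tame_algebraic S K hr hs his)).trans hK).trans
      le_add_self
  have hinit : ((0 + 0 + 1 : ℕ) : Cardinal) ≤ Algebra.trdeg ℚ ↥(IntermediateField.adjoin ℚ (Set.range (Fin.append (fun j => (((![S.u] : Fin (0 + 1) → ℝ) j : ℝ) : ℂ)) (fun j => (((![S.u] : Fin (0 + 1) → ℝ) j : ℝ) : ℂ) * Complex.I)) ∪ Set.range (S.E ∘ Fin.append (fun j => (((![S.u] : Fin (0 + 1) → ℝ) j : ℝ) : ℂ)) (fun j => (((![S.u] : Fin (0 + 1) → ℝ) j : ℝ) : ℂ) * Complex.I)))) := by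
    have hmem : ((S.u : ℝ) : ℂ) ∈ Set.range (Fin.append (fun j => (((![S.u] : Fin (0 + 1) → ℝ) j : ℝ) : ℂ)) (fun j => (((![S.u] : Fin (0 + 1) → ℝ) j : ℝ) : ℂ) * Complex.I)) :=
      ⟨Fin.castAdd (0 + 1) 0, by rw [Fin.append_left]; simp⟩
    exact_mod_cast one_le_trdeg_of_transcendental_mem'
      (IntermediateField.subset_adjoin ℚ _ (Set.mem_union_left _ hmem)) hut
  have h1 := (h 0 ![S.u] hli (kleinIH_one S.E) htame hinit).trans
    ((RootDecomp1EAnchor.trdeg_adjoin_le_of_isAlgebraic (cellOne_algebraic S K hr hs his)).trans hK)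
  norm_num at h1

/-- **`S(2)` FAILS** for a shear with `trdeg ℚ(u, e^ℓ, e^{iℓ}) ≤ 1`, `u ≠ 0`, at the `ℚ`-free
`conj`-stable polar pair `(u, iu)`. [folklore] -/
theorem not_schanuelRankE_two_shear (hK : Algebra.trdeg ℚ K ≤ 1) (hr : ((S.u : ℝ) : ℂ) ∈ K)
    (hs : cexp (S.ℓ : ℂ) ∈ K) (his : cexp ((S.ℓ : ℂ) * I) ∈ K) (hu0 : S.u ≠ 0) :
    ¬ SchanuelRankE S.E 2 := by
  intro h
  have h1 := (h ![((S.u : ℝ) : ℂ), ((S.u : ℝ) : ℂ) * I] (linearIndependent_ofReal_pair hu0)).trans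
    ((RootDecomp1EAnchor.trdeg_adjoin_le_of_isAlgebraic (polarPair_algebraic S K hr hs his)).trans hK)
  norm_num at h1

/-- … hence the summit text fails for such a shear. [folklore] -/
theorem not_schanuelE_shear (hK : Algebra.trdeg ℚ K ≤ 1) (hr : ((S.u : ℝ) : ℂ) ∈ K)
    (hs : cexp (S.ℓ : ℂ) ∈ K) (his : cexp ((S.ℓ : ℂ) * I) ∈ K) (hu0 : S.u ≠ 0) :
    ¬ SchanuelE S.E := fun h =>
  not_schanuelRankE_two_shear S K hK hr hs his hu0 (h 2)

end ShearFloor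

/-- **PERIOD-FLOOR REDUCTION** (strengthens `kFiveX_reduction`): a certified real pair `(r, s)` with
`r, s ∉ A ⊕ Aπ`, `trdeg ℚ(r, e^s, e^{is}) ≤ 1` yields an exponential with (E1)–(E4), the true
kernel, the period plane and (granted `nesterenko`) Nesterenko verbatim which FAILS the length-one
cell at `r`, `X`, `LSB` (at length one), `T0` (at storey zero), `S(2)` (at `(r, ir)`) and the
summit text. [folklore] -/
theorem periodFloor_reduction {r s : ℝ} (hr : r ∉ spanOnePi) (hs : s ∉ spanOnePi)
    (K : IntermediateField ℚ ℂ) (hK : Algebra.trdeg ℚ K ≤ 1) (hrK : ((r : ℝ) : ℂ) ∈ K)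
    (hsK : cexp (s : ℂ) ∈ K) (hisK : cexp ((s : ℂ) * I) ∈ K) :
    ∃ E : ℂ → ℂ, TranscendencePackage E ∧ TrueKernel E ∧ AgreesOnPeriodPlane E ∧
      (nesterenko → NesterenkoE E) ∧ ¬ KleinPolarCellOne E r ∧ ¬ KleinPolarE E ∧
      ¬ LocalSurplusBudgetE E ∧ ¬ TameDefectZeroStepE E ∧ ¬ SchanuelRankE E 2 ∧ ¬ SchanuelE E := by
  obtain ⟨S, hφπ, hu, hℓ⟩ := exists_pinned_shear_moving hr hs
  subst hu hℓ
  have hcell := not_kleinPolarCellOne_shear S K hK hrK hsK hisK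
  have hr0 : S.u ≠ 0 := ne_zero_of_not_mem_spanOnePi hr
  have hut : Transcendental ℚ ((S.u : ℝ) : ℂ) := transcendental_of_not_mem_spanOnePi hr
  exact ⟨S.E, transcendencePackage_shear S, trueKernel_of S hφπ, agreesOnPeriodPlane_of S hφπ,
    fun hN => nesterenkoE_of S hN hφπ, hcell, fun hX => hcell (kleinPolarCellOne_of_kleinPolarE hX hr0),
    not_localSurplusBudgetE_shear S K hK hrK hsK hisK hut,
    not_tameDefectZeroStepE_shear S K hK hrK hsK hisK hut,
    not_schanuelRankE_two_shear S K hK hrK hsK hisK hr0,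
    not_schanuelE_shear S K hK hrK hsK hisK hr0⟩

/-- FIRST ALTERNATIVE of the dichotomy, full profile. [folklore] -/
theorem periodFloor_of_γ₀_not_mem (h : γ₀ ∉ spanOnePi) :
    ∃ E : ℂ → ℂ, TranscendencePackage E ∧ TrueKernel E ∧ AgreesOnPeriodPlane E ∧
      (nesterenko → NesterenkoE E) ∧ ¬ KleinPolarCellOne E γ₀ ∧ ¬ KleinPolarE E ∧
      ¬ LocalSurplusBudgetE E ∧ ¬ TameDefectZeroStepE E ∧ ¬ SchanuelRankE E 2 ∧ ¬ SchanuelE E := by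
  refine periodFloor_reduction h s₀_not_mem_spanOnePi
    (IntermediateField.adjoin ℚ ({(γ₀ : ℂ), β₀} : Set ℂ)) (trdeg_adjoin_pair_le_one _ β₀_isAlgebraic)
    (IntermediateField.subset_adjoin ℚ _ (Set.mem_insert _ _)) ?_ ?_
  · rw [exp_s₀]
    exact IntermediateField.subset_adjoin ℚ _ (Set.mem_insert _ _)
  · rw [exp_s₀_mul_I]
    exact IntermediateField.subset_adjoin ℚ _ (Set.mem_insert_of_mem _ rfl)

/-- SECOND ALTERNATIVE of the dichotomy, full profile. [folklore] -/
theorem periodFloor_of_γ₀_sq_not_mem (h : γ₀ ^ 2 ∉ spanOnePi) :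
    ∃ E : ℂ → ℂ, TranscendencePackage E ∧ TrueKernel E ∧ AgreesOnPeriodPlane E ∧
      (nesterenko → NesterenkoE E) ∧ ¬ KleinPolarCellOne E (γ₀ ^ 2) ∧ ¬ KleinPolarE E ∧
      ¬ LocalSurplusBudgetE E ∧ ¬ TameDefectZeroStepE E ∧ ¬ SchanuelRankE E 2 ∧ ¬ SchanuelE E := by
  have hb : IsAlgebraic ℚ (β₀ ^ 2) := by
    rw [pow_two]
    exact β₀_isAlgebraic.mul β₀_isAlgebraic
  have e1 : cexp ((2 * s₀ : ℝ) : ℂ) = ((γ₀ ^ 2 : ℝ) : ℂ) := by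
    push_cast
    rw [show (2 : ℂ) * (s₀ : ℂ) = (s₀ : ℂ) + (s₀ : ℂ) by ring, Complex.exp_add, exp_s₀]
    ring
  have e2 : cexp (((2 * s₀ : ℝ) : ℂ) * I) = β₀ ^ 2 := by
    push_cast
    rw [show (2 : ℂ) * (s₀ : ℂ) * I = (s₀ : ℂ) * I + (s₀ : ℂ) * I by ring, Complex.exp_add,
      exp_s₀_mul_I]
    ring
  refine periodFloor_reduction h two_mul_s₀_not_mem_spanOnePi
    (IntermediateField.adjoin ℚ ({((γ₀ ^ 2 : ℝ) : ℂ), β₀ ^ 2} : Set ℂ)) (trdeg_adjoin_pair_le_one _ hb)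
    (IntermediateField.subset_adjoin ℚ _ (Set.mem_insert _ _)) ?_ ?_
  · rw [e1]
    exact IntermediateField.subset_adjoin ℚ _ (Set.mem_insert _ _)
  · rw [e2]
    exact IntermediateField.subset_adjoin ℚ _ (Set.mem_insert_of_mem _ rfl)

/-- **THE PERIOD FLOOR, FULL PROFILE (no conjecture; Nesterenko only for (P3))**: an exponential with
(E1)–(E4), (P1), (P2) (and (P3) granted `nesterenko`) and a real `r ≠ 0` (`= γ₀` or `γ₀²`) at which
the length-one cell fails, together with `X`, `LSB`, `T0`, `S(2)` and the summit text. [folklore] -/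
theorem periodFloor : ∃ (E : ℂ → ℂ) (r : ℝ), r ≠ 0 ∧ TranscendencePackage E ∧ TrueKernel E ∧
    AgreesOnPeriodPlane E ∧ (nesterenko → NesterenkoE E) ∧ ¬ KleinPolarCellOne E r ∧
    ¬ KleinPolarE E ∧ ¬ LocalSurplusBudgetE E ∧ ¬ TameDefectZeroStepE E ∧ ¬ SchanuelRankE E 2 ∧
    ¬ SchanuelE E := by
  rcases γ₀_or_γ₀_sq_not_mem with h | h
  · obtain ⟨E, hE⟩ := periodFloor_of_γ₀_not_mem h
    exact ⟨E, γ₀, γ₀_pos.ne', hE⟩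
  · obtain ⟨E, hE⟩ := periodFloor_of_γ₀_sq_not_mem h
    exact ⟨E, γ₀ ^ 2, (pow_pos γ₀_pos 2).ne', hE⟩

/-- **PERIOD PACKAGE FLOOR — pinning the period costs nothing.** Granted Nesterenko's theorem (for
(P3)), ONE exponential with the FULL period package (E1)–(E4), (P1)–(P3) fails Klein-polar Schanuel,
the Local Surplus Budget, the Tame Defect-Zero Step, Schanuel in rank two and the summit text — the
profile of the twist floor `transcendencePackageFloor` (part TPF05), with the periods pinned.
[cite: Nesterenko1996SbMath, Theorem 1 and its corollaries] -/
theorem periodPackageFloor (hN : nesterenko) :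
    ∃ E : ℂ → ℂ, PeriodPackage E ∧ ¬ KleinPolarE E ∧ ¬ LocalSurplusBudgetE E ∧
      ¬ TameDefectZeroStepE E ∧ ¬ SchanuelRankE E 2 ∧ ¬ SchanuelE E := by
  obtain ⟨E, r, -, hT, hK, hP, hNE, -, hX, hL, hT0, hS2, hS⟩ := periodFloor
  exact ⟨E, ⟨hT, hK, hP, hNE hN⟩, hX, hL, hT0, hS2, hS⟩

/-- **`LocalSurplusBudget` IS FALSE WITHOUT A CHANNEL BEYOND THE PERIOD PACKAGE** (crux
stmt-Schanuel-27214; at `E = exp` the statement is the route item, `localSurplusBudgetE_exp_iff`).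
[cite: Nesterenko1996SbMath, Theorem 1 and its corollaries] -/
theorem localSurplusBudget_false_without_channel_beyond_periods (hN : nesterenko) :
    ¬ ∀ E : ℂ → ℂ, PeriodPackage E → LocalSurplusBudgetE E := by
  intro h
  obtain ⟨E, hP, -, hL, -⟩ := periodPackageFloor hN
  exact hL (h E hP)

/-- **`TameDefectZeroStep` IS FALSE WITHOUT A CHANNEL BEYOND THE PERIOD PACKAGE** (crux
stmt-Schanuel-32407; at `E = exp` the statement is the route item, `tameDefectZeroStepE_exp_iff`).
[cite: Nesterenko1996SbMath, Theorem 1 and its corollaries] -/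
theorem tameDefectZeroStep_false_without_channel_beyond_periods (hN : nesterenko) :
    ¬ ∀ E : ℂ → ℂ, PeriodPackage E → TameDefectZeroStepE E := by
  intro h
  obtain ⟨E, hP, -, -, hT0, -⟩ := periodPackageFloor hN
  exact hT0 (h E hP)

/-- **`KleinPolarSchanuel` IS FALSE WITHOUT A CHANNEL BEYOND THE PERIOD PACKAGE — already at length
one** (sharpens PKF02's length-two statement). [cite: Nesterenko1996SbMath, Theorem 1 and its corollaries] -/
theorem kleinPolarSchanuel_false_without_channel_beyond_periods' (hN : nesterenko) :
    ¬ ∀ E : ℂ → ℂ, PeriodPackage E → KleinPolarE E := by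
  intro h
  obtain ⟨E, hP, hX, -⟩ := periodPackageFloor hN
  exact hX (h E hP)

/-- HYPOTHESIS-FREE FORM for `LSB`: `¬ ∀ E, (E1)–(E4) → (P1) → (P2) → LSB_E`. [folklore] -/
theorem localSurplusBudget_false_without_channel_beyond_kernel_and_period_plane :
    ¬ ∀ E : ℂ → ℂ, TranscendencePackage E → TrueKernel E → AgreesOnPeriodPlane E →
      LocalSurplusBudgetE E := by
  intro h
  obtain ⟨E, r, -, hT, hK, hP, -, -, -, hL, -⟩ := periodFloor
  exact hL (h E hT hK hP)

/-- HYPOTHESIS-FREE FORM for `T0`: `¬ ∀ E, (E1)–(E4) → (P1) → (P2) → T0_E`. [folklore] -/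
theorem tameDefectZeroStep_false_without_channel_beyond_kernel_and_period_plane :
    ¬ ∀ E : ℂ → ℂ, TranscendencePackage E → TrueKernel E → AgreesOnPeriodPlane E →
      TameDefectZeroStepE E := by
  intro h
  obtain ⟨E, r, -, hT, hK, hP, -, -, -, -, hT0, -⟩ := periodFloor
  exact hT0 (h E hT hK hP)

/-- HYPOTHESIS-FREE FORM for the summit text: `¬ ∀ E, (E1)–(E4) → (P1) → (P2) → S_E`. [folklore] -/
theorem schanuel_false_without_channel_beyond_kernel_and_period_plane :
    ¬ ∀ E : ℂ → ℂ, TranscendencePackage E → TrueKernel E → AgreesOnPeriodPlane E → SchanuelE E := by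
  intro h
  obtain ⟨E, r, -, hT, hK, hP, -, -, -, -, -, -, hS⟩ := periodFloor
  exact hS (h E hT hK hP)

/-- DICTIONARY: the genuine exponential has the period package (granted `nesterenko`), and its
instances of the five statements ARE the route items / the tree's `SchanuelRank 2` / the summit —
so none of them is a consequence of (E1)–(E4), (P1)–(P3). [folklore] -/
theorem periodPackageFloor_exp_dictionary (hN : nesterenko) :
    PeriodPackage cexp ∧
      (KleinPolarE cexp ↔ Summit.Schanuel.Schanuel.Theses.RootDecomp1B.KleinPolarSchanuel) ∧
      (LocalSurplusBudgetE cexp ↔ Summit.Schanuel.Schanuel.Theses.RootDecomp1B.LocalSurplusBudget) ∧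
      (TameDefectZeroStepE cexp ↔ Summit.Schanuel.Schanuel.Theses.RootDecomp1B.TameDefectZeroStep) ∧
      (SchanuelE cexp ↔ Schanuel) :=
  ⟨periodPackage_exp hN, kleinPolarE_exp_iff, localSurplusBudgetE_exp_iff, tameDefectZeroStepE_exp_iff,
    schanuelE_exp_iff⟩

end Summit.Schanuel.Schanuel.Theorems.RootDecomp1BFinitePinningFloor

end
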